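import Mathlib
import Summits.Ventures.PercRepro2.SkeletonOneBranch
import Summits.Ventures.PercRepro2.StarHMulti

/-!
# The marks-only class modulo reduction; cycles and necklaces at (HMF) strength (blind cell
PercRepro2, night-1 g16; NIGHT1-G16.md §5‴)

g13's single-vertex theorem `StarH.HMF_star_marks` ((HMF) whenever every edge at `a₃` joins `a₃` to a
mark — any subset of the marks, any multiplicities, `a₃` isolated included) transported along the
reduction relation: **`HMF_of_reduces_marks_at_a3`** (the class on the nonzero edges of any reduct),
hence **`HMF_of_card_nzNbr_le_two`** / **`HMF_of_nzDeg_le_two`** — (HMF), not only (HCOV), whenever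
every unmarked vertex has at most two nonzero neighbours (resp. nonzero-degree `≤ 2`), with NO
condition on `a₃`: cycles and necklaces with the five marks placed anywhere (S3.7 (C7)) at (HMF)
strength.

Own code; standard axioms.
-/

open scoped Classical

namespace Summit.Ventures.PercRepro2

open UnionCluster CovForm

namespace Skeleton

section Marks

variable {V : Type*} {E : Type*} [Fintype E] [DecidableEq E] [Fintype V] [DecidableEq V]
  {R : Type*} [Field R] [LinearOrder R] [IsStrictOrderedRing R]

variable {o a₁ a₂ a₃ b : V}

/-- **The marks-only class modulo reduction (HMF)**: if the instance reduces to one in which every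
nonzero edge at `a₃` joins `a₃` to a mark, (HMF) holds. -/
theorem HMF_of_reduces_marks_at_a3 {p : E → R} {ends : E → Sym2 V} (hp : IsProbVec p)
    {q : E → R} {ends' : E → Sym2 V} (h : Reduces o a₁ a₂ a₃ b (p, ends) (q, ends'))
    (hR : ∀ e, q e ≠ 0 → a₃ ∈ ends' e → ends' e = s(a₃, a₁) ∨ ends' e = s(a₃, a₂) ∨
      ends' e = s(a₃, o) ∨ ends' e = s(a₃, b))
    (h31 : a₃ ≠ a₁) (h32 : a₃ ≠ a₂) (h3o : a₃ ≠ o) (h3b : a₃ ≠ b) :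
    HMF p ends o a₁ a₂ a₃ b := by
  have h' : Reduces o a₁ a₂ a₃ b (p, ends) (q, reroute q ends' a₁) :=
    Relation.ReflTransGen.tail h (Step.reroute fun _ he => (reroute_of_ne q ends' a₁ he).symm)
  refine HMF_of_reduces (I := (p, ends)) h' hp ?_
  refine StarH.HMF_star_marks q _ (isProbVec_of_reduces (I := (p, ends)) h hp) ?_ h31 h32 h3o h3b
  intro e he
  dsimp only at he ⊢
  have hqe : q e ≠ 0 := ne_zero_of_mem_reroute q ends' h31 he
  rw [reroute_of_ne q ends' a₁ hqe] at he ⊢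
  exact hR e hqe he

omit [IsStrictOrderedRing R] in
/-- In a simple reduct of an instance whose unmarked vertices have at most two nonzero neighbours,
every nonzero edge at `a₃` joins `a₃` to a mark. -/
lemma marks_at_a3_of_simple {p : E → R} {ends : E → Sym2 V}
    {q : E → R} {ends' : E → Sym2 V} (h : Reduces o a₁ a₂ a₃ b (p, ends) (q, ends'))
    (hs : Simple q ends' o a₁ a₂ a₃ b)
    (hnbr : ∀ v, v ≠ o → v ≠ a₁ → v ≠ a₂ → v ≠ a₃ → v ≠ b → (nzNbr p ends v).card ≤ 2) :
    ∀ e, q e ≠ 0 → a₃ ∈ ends' e → ends' e = s(a₃, a₁) ∨ ends' e = s(a₃, a₂) ∨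
      ends' e = s(a₃, o) ∨ ends' e = s(a₃, b) := by
  intro e he hae
  obtain ⟨y, hy⟩ := Sym2.mem_iff_exists.1 hae
  have hnoloop := hs.2.1
  have hy3 : y ≠ a₃ := by
    intro hh; subst hh
    exact hnoloop e he (by rw [hy]; exact Sym2.mk_isDiag_iff.2 rfl)
  by_cases hy1 : y = a₁
  · left; rw [hy, hy1]
  by_cases hy2 : y = a₂
  · right; left; rw [hy, hy2]
  by_cases hyo : y = o
  · right; right; left; rw [hy, hyo]
  by_cases hyb : y = b
  · right; right; right; rw [hy, hyb]
  exfalso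
  exact notMem_of_simple_of_card_nzNbr_le_two hs hyo hy1 hy2 hy3 hyb
    (le_trans (card_nzNbr_le_of_reduces (I := (p, ends)) (J := (q, ends')) h y)
      (hnbr y hyo hy1 hy2 hy3 hyb)) he (by rw [hy]; exact Sym2.mem_mk_right a₃ y)

/-- **(HMF) without unmarked branch vertices, no condition on `a₃`**: if every unmarked vertex has at
most two nonzero neighbours (parallel edges and loops allowed), (HMF) holds — cycles and necklaces
with the five marks placed anywhere. -/
theorem HMF_of_card_nzNbr_le_two (p : E → R) (ends : E → Sym2 V) (hp : IsProbVec p)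
    (h31 : a₃ ≠ a₁) (h32 : a₃ ≠ a₂) (h3o : a₃ ≠ o) (h3b : a₃ ≠ b)
    (hnbr : ∀ v, v ≠ o → v ≠ a₁ → v ≠ a₂ → v ≠ a₃ → v ≠ b → (nzNbr p ends v).card ≤ 2) :
    HMF p ends o a₁ a₂ a₃ b := by
  obtain ⟨J, hJ, hJs⟩ := exists_reduces_simple o a₁ a₂ a₃ b p ends hp
  obtain ⟨q, ends'⟩ := J
  exact HMF_of_reduces_marks_at_a3 hp hJ (marks_at_a3_of_simple hJ hJs hnbr) h31 h32 h3o h3b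

/-- The degree form: every unmarked vertex of nonzero-degree `≤ 2`. -/
theorem HMF_of_nzDeg_le_two (p : E → R) (ends : E → Sym2 V) (hp : IsProbVec p)
    (h31 : a₃ ≠ a₁) (h32 : a₃ ≠ a₂) (h3o : a₃ ≠ o) (h3b : a₃ ≠ b)
    (hdeg : ∀ v, v ≠ o → v ≠ a₁ → v ≠ a₂ → v ≠ a₃ → v ≠ b → nzDeg p ends v ≤ 2) :
    HMF p ends o a₁ a₂ a₃ b := by
  obtain ⟨J, hJ, hJs⟩ := exists_reduces_simple o a₁ a₂ a₃ b p ends hp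
  obtain ⟨q, ends'⟩ := J
  refine HMF_of_reduces_marks_at_a3 hp hJ ?_ h31 h32 h3o h3b
  intro e he hae
  obtain ⟨y, hy⟩ := Sym2.mem_iff_exists.1 hae
  have hnoloop := hJs.2.1
  dsimp only at hnoloop
  have hy3 : y ≠ a₃ := by
    intro hh; subst hh
    exact hnoloop e he (by rw [hy]; exact Sym2.mk_isDiag_iff.2 rfl)
  by_cases hy1 : y = a₁
  · left; rw [hy, hy1]
  by_cases hy2 : y = a₂
  · right; left; rw [hy, hy2]
  by_cases hyo : y = o
  · right; right; left; rw [hy, hyo]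
  by_cases hyb : y = b
  · right; right; right; rw [hy, hyb]
  exfalso
  have hle : nzDeg q ends' y ≤ 2 :=
    le_trans (nzDeg_le_of_reduces (I := (p, ends)) (J := (q, ends')) hJ y) (hdeg y hyo hy1 hy2 hy3 hyb)
  have hpos : 1 ≤ nzDeg q ends' y := by
    rw [nzDeg_eq_card]
    exact Finset.card_pos.2 ⟨e, mem_nzAt.2 ⟨by rw [hy]; exact Sym2.mem_mk_right a₃ y, he⟩⟩
  have hs := (hJs.1 y hyo hy1 hy2 hy3 hyb).2
  dsimp only at hs
  rcases hs with h0 | h3 <;> omega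

end Marks

end Skeleton

end Summit.Ventures.PercRepro2
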